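import Mathlib.Analysis.Convex.Deriv
import Literature.Geometry.Lorentzian.KerrSeparatedPotentialBounds
import Literature.Geometry.Lorentzian.KerrSurfaceGravity
import HarnessLib

/-!
# The geometric factor `Δ/(r² + a²)²` of Carter's potential is unimodal on the Kerr exterior
(namespace `Literature.Geometry.Lorentzian.Kerr`.)

The principal part of the potential of Carter's radial equation is `V₀ = (ΔΛ + …)/(r² + a²)²`
(DRSR arXiv:1402.7034 §6.2); at the superradiant threshold the whole barrier coefficient is
`(V − ω²) = [Δ·J + W₁]/(r² + a²)²` with `J` decreasing (`CarterThresholdRate.lean`). The purely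
geometric weight

  `D(r) := Δ(r)/(r² + a²)²`,  `Δ = r² − 2Mr + a²`,

vanishes at `r₊`, decays like `r⁻²` at infinity, and is UNIMODAL in between: with
`p(r) := −r³ + 3Mr² − a²r − Ma²` one has `D′ = 2p/(r² + a²)³` (`hasDerivAt_deltaWeight`), `p` is
concave on `[M, ∞)` (`p″ = 6(M − r)`), `p(r₊) = 2M(Mr₊ − a²) ≥ 0` and `p < 0` beyond `3M`; hence
there is a radius `r_D ∈ [r₊, 3M]` with `D` non-decreasing on `[r₊, r_D]` and non-increasing on
`[r_D, ∞)` (`exists_deltaWeight_unimodal`), and consequently the minimum of `D` over any interval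
`[x, y] ⊆ [r₊, ∞)` is attained at an end point (`min_deltaWeight_le`).

This is the shape input for certifying `V − ω² ≥ k²` on sub-barriers from pointwise two-sided
bounds `Δ·J ≤ (r² + a²)²(V − ω²)` (near-extremal Kerr programme, threshold tunnelling estimates).
Everything is elementary real algebra; no statement about `V` itself is made here.

## References
* M. Dafermos, I. Rodnianski, Y. Shlapentokh-Rothman, arXiv:1402.7034 = Ann. of Math. 183 (2016),
  §§2.1.2, 6.2–6.3 (key `DafermosRodnianskiShlapentokhrothman2014`). The computation is folklore.
-/

noncomputable section

open Set

namespace Literature.Geometry.Lorentzian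

namespace Kerr

/-! ### The derivative of `Δ/(r² + a²)²` -/

/-- `d/dr [Δ/(r² + a²)²] = 2(−r³ + 3Mr² − a²r − Ma²)/(r² + a²)³` wherever `r² + a² ≠ 0`. [folklore] -/
theorem hasDerivAt_deltaWeight (M a : ℝ) {r : ℝ} (hA : r ^ 2 + a ^ 2 ≠ 0) :
    HasDerivAt (fun s : ℝ ↦ delta M a s / (s ^ 2 + a ^ 2) ^ 2)
      (2 * (-r ^ 3 + 3 * M * r ^ 2 - a ^ 2 * r - M * a ^ 2) / (r ^ 2 + a ^ 2) ^ 3) r := by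
  have h1 := hasDerivAt_delta M a r
  have h2 := hasDerivAt_sq_add_sq_pow a 2 r
  have hA2 : (r ^ 2 + a ^ 2) ^ 2 ≠ 0 := pow_ne_zero 2 hA
  refine (h1.div h2 hA2).congr_deriv ?_
  unfold delta
  field_simp
  push_cast
  ring

/-! ### Unimodality -/

/-- The cubic `p(r) = −r³ + 3Mr² − a²r − Ma²` is concave on `[M, ∞)` (`p″ = 6(M − r) ≤ 0`).
[folklore] -/
theorem concaveOn_deltaWeight_numerator (M a : ℝ) :
    ConcaveOn ℝ (Ici M) (fun r : ℝ ↦ -r ^ 3 + 3 * M * r ^ 2 - a ^ 2 * r - M * a ^ 2) := by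
  have hd : ∀ r, HasDerivAt (fun r : ℝ ↦ -r ^ 3 + 3 * M * r ^ 2 - a ^ 2 * r - M * a ^ 2)
      (-3 * r ^ 2 + 6 * M * r - a ^ 2) r := by
    intro r
    have h := ((((hasDerivAt_pow 3 r).neg).add ((hasDerivAt_pow 2 r).const_mul (3 * M))).sub
      ((hasDerivAt_id r).const_mul (a ^ 2))).sub_const (M * a ^ 2)
    refine h.congr_deriv ?_
    simp; ring
  have hd2 : ∀ r, HasDerivAt (fun r : ℝ ↦ -3 * r ^ 2 + 6 * M * r - a ^ 2) (6 * (M - r)) r := by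
    intro r
    have h := (((hasDerivAt_pow 2 r).const_mul (-3)).add ((hasDerivAt_id r).const_mul (6 * M))).sub_const
      (a ^ 2)
    refine h.congr_deriv ?_
    simp; ring
  refine concaveOn_of_hasDerivWithinAt2_nonpos (convex_Ici M)
    (fun r _ ↦ (hd r).continuousAt.continuousWithinAt)
    (fun r _ ↦ (hd r).hasDerivWithinAt) (fun r _ ↦ (hd2 r).hasDerivWithinAt) ?_
  intro r hr
  rw [interior_Ici] at hr
  have : M < r := hr
  nlinarith

/-- **`Δ/(r² + a²)²` is unimodal on `[r₊, ∞)`** (`0 < M`, `|a| ≤ M`): there is `r_D ∈ [r₊, 3M]` such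
that `r ↦ Δ(r)/(r² + a²)²` is non-decreasing on `[r₊, r_D]` and non-increasing on `[r_D, ∞)`.
Proof: `D′ = 2p/(r² + a²)³`, `p` concave on `[M, ∞)` with `p(r₊) = 2M(Mr₊ − a²) ≥ 0` and
`p(r) < 0` for `r > 3M`, so `{p ≥ 0} ∩ [r₊, ∞) = [r₊, r_D]`. [folklore] -/
theorem exists_deltaWeight_unimodal {M a : ℝ} (hM : 0 < M) (ha : |a| ≤ M) :
    ∃ rD, rPlus M a ≤ rD ∧ rD ≤ 3 * M ∧
      MonotoneOn (fun r : ℝ ↦ delta M a r / (r ^ 2 + a ^ 2) ^ 2) (Icc (rPlus M a) rD) ∧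
      AntitoneOn (fun r : ℝ ↦ delta M a r / (r ^ 2 + a ^ 2) ^ 2) (Ici rD) := by
  set p : ℝ → ℝ := fun r ↦ -r ^ 3 + 3 * M * r ^ 2 - a ^ 2 * r - M * a ^ 2 with hp
  have hrp : 0 < rPlus M a := rPlus_pos hM a
  have hMr : M ≤ rPlus M a := M_le_rPlus M a
  have hr2 : rPlus M a ≤ 2 * M := rPlus_le_two_mul_self hM.le a
  have ha2 : a ^ 2 ≤ M ^ 2 := by nlinarith [sq_abs a, abs_nonneg a]
  -- `p(r₊) ≥ 0`
  have hp0 : 0 ≤ p (rPlus M a) := by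
    have e : p (rPlus M a) = 2 * M * (M * rPlus M a - a ^ 2) := by
      have hsq : rPlus M a ^ 2 + a ^ 2 = 2 * M * rPlus M a := rPlus_sq_add_sq ha
      simp only [hp]
      nlinarith [hsq]
    rw [e]
    have : a ^ 2 ≤ M * rPlus M a := by nlinarith
    positivity
  -- `p(r) < 0` for `r > 3M`
  have hpneg : ∀ r, 3 * M < r → p r < 0 := by
    intro r hr
    simp only [hp]
    have hr0 : 0 < r := by linarith
    nlinarith [sq_nonneg a, mul_pos hr0 hr0, mul_pos hM hr0, sq_nonneg (r - 3 * M)]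
  -- the superlevel set `S = {r ∈ [r₊, ∞) | p r ≥ 0}` and `r_D = sup S`
  set S : Set ℝ := {r | rPlus M a ≤ r ∧ 0 ≤ p r} with hS
  have hS0 : rPlus M a ∈ S := ⟨le_rfl, hp0⟩
  have hSbdd : BddAbove S := ⟨3 * M, fun r hr ↦ le_of_not_gt fun h ↦ absurd hr.2 (not_le.2 (hpneg r h))⟩
  set rD := sSup S with hrD
  have hrD0 : rPlus M a ≤ rD := le_csSup hSbdd hS0
  have hrD3 : rD ≤ 3 * M := csSup_le ⟨_, hS0⟩ fun r hr ↦
    le_of_not_gt fun h ↦ absurd hr.2 (not_le.2 (hpneg r h))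
  have hconc := concaveOn_deltaWeight_numerator M a
  -- `p ≥ 0` on `[r₊, r_D)`: concavity between `r₊` and a point of `S` beyond
  have hp_nonneg : ∀ r, rPlus M a ≤ r → r < rD → 0 ≤ p r := by
    intro r hr hrlt
    obtain ⟨y, hyS, hry⟩ := exists_lt_of_lt_csSup ⟨_, hS0⟩ hrlt
    have h := hconc.min_le_of_mem_Icc (x := rPlus M a) (y := y) (z := r) hMr (hMr.trans hyS.1)
      ⟨hr, hry.le⟩
    exact le_trans (le_min hp0 hyS.2) h
  -- `p ≤ 0` on `(r_D, ∞)`: such points are not in `S`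
  have hp_nonpos : ∀ r, rD < r → p r ≤ 0 := by
    intro r hr
    by_contra hcon
    push Not at hcon
    have : r ∈ S := ⟨hrD0.trans hr.le, hcon.le⟩
    exact absurd (le_csSup hSbdd this) (not_le.2 hr)
  -- the derivative of `D`
  have hD : ∀ r, rPlus M a ≤ r → HasDerivAt (fun s : ℝ ↦ delta M a s / (s ^ 2 + a ^ 2) ^ 2)
      (2 * p r / (r ^ 2 + a ^ 2) ^ 3) r := by
    intro r hr
    have hr0 : 0 < r := hrp.trans_le hr
    exact hasDerivAt_deltaWeight M a (by positivity)
  refine ⟨rD, hrD0, hrD3, ?_, ?_⟩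
  · refine monotoneOn_of_hasDerivWithinAt_nonneg (convex_Icc _ _)
      (fun r hr ↦ (hD r hr.1).continuousAt.continuousWithinAt)
      (fun r hr ↦ (hD r (interior_subset (s := Icc (rPlus M a) rD) hr).1).hasDerivWithinAt) ?_
    intro r hr
    rw [interior_Icc] at hr
    have hr0 : 0 < r := hrp.trans hr.1
    have := hp_nonneg r hr.1.le hr.2
    positivity
  · refine antitoneOn_of_hasDerivWithinAt_nonpos (convex_Ici _)
      (fun r hr ↦ (hD r (hrD0.trans hr)).continuousAt.continuousWithinAt)
      (fun r hr ↦ (hD r (hrD0.trans (interior_subset (s := Ici rD) hr))).hasDerivWithinAt) ?_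
    intro r hr
    rw [interior_Ici] at hr
    have hr' : rD < r := hr
    have hr0 : 0 < r := hrp.trans_le (hrD0.trans hr'.le)
    have h1 := hp_nonpos r hr'
    have h2 : 0 < (r ^ 2 + a ^ 2) ^ 3 := by positivity
    exact div_nonpos_of_nonpos_of_nonneg (by linarith) h2.le

/-- **The minimum of a unimodal function over an interval is at an end point.** If `f` is
non-decreasing on `[A, c]` and non-increasing on `[c, ∞)`, then for `A ≤ x ≤ z ≤ y`:
`min (f x) (f y) ≤ f z`. [folklore] -/
theorem min_le_of_monotoneOn_antitoneOn {f : ℝ → ℝ} {A c x y z : ℝ}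
    (hmono : MonotoneOn f (Icc A c)) (hanti : AntitoneOn f (Ici c)) (hx : A ≤ x)
    (hz : z ∈ Icc x y) : min (f x) (f y) ≤ f z := by
  rcases le_total z c with hzc | hcz
  · -- `x ≤ z ≤ c`: `f x ≤ f z`
    exact (min_le_left _ _).trans (hmono ⟨hx, hz.1.trans hzc⟩ ⟨hx.trans hz.1, hzc⟩ hz.1)
  · -- `c ≤ z ≤ y`: `f y ≤ f z`
    exact (min_le_right _ _).trans (hanti (show c ≤ z from hcz) (show c ≤ y from hcz.trans hz.2) hz.2)

/-- **The minimum of `Δ/(r² + a²)²` over `[x, y] ⊆ [r₊, ∞)` is at an end point** (`0 < M`,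
`|a| ≤ M`): for `r₊ ≤ x ≤ z ≤ y`, `min (D x) (D y) ≤ D z`. [folklore] -/
theorem min_deltaWeight_le {M a : ℝ} (hM : 0 < M) (ha : |a| ≤ M) {x y z : ℝ}
    (hx : rPlus M a ≤ x) (hz : z ∈ Icc x y) :
    min (delta M a x / (x ^ 2 + a ^ 2) ^ 2) (delta M a y / (y ^ 2 + a ^ 2) ^ 2) ≤
      delta M a z / (z ^ 2 + a ^ 2) ^ 2 := by
  obtain ⟨rD, -, -, hmono, hanti⟩ := exists_deltaWeight_unimodal hM ha
  exact min_le_of_monotoneOn_antitoneOn (f := fun r : ℝ ↦ delta M a r / (r ^ 2 + a ^ 2) ^ 2)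
    hmono hanti hx hz

end Kerr

end Literature.Geometry.Lorentzian

end
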